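import Literature.NumberTheory.EllipticCurves.Gamma0RankinSelbergUnfolding
import Literature.NumberTheory.EllipticCurves.RankinSelbergStripIntegral
import Literature.NumberTheory.EllipticCurves.Gamma0EisensteinResidue
import Literature.NumberTheory.EllipticCurves.Gamma0EisensteinBound
import Literature.NumberTheory.EllipticCurves.HeckeOperatorsPeterssonProofs
import HarnessLib

/-!
# The Rankin–Selberg residue identity for the Petersson norm on `Γ₀(N)`

Topic `Literature/NumberTheory/EllipticCurves`; theorems only (no definition, no named fact). Seventh
brick — the assembly — of the printed proof behind the named fact
`murty_petersson_newform_lower_bound` (`NewformPeterssonSize.lean`; M. R. Murty, *Bounds for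
congruence primes* (1999), §2: "`(f, f) = N^{1+o(1)} L(1, sym² f)` by Rankin–Selberg unfolding, and
`L(1, sym² f) ≫_ε N^{-ε}` by Hoffstein–Lockhart"). For every cusp form `f ∈ S₂(Γ₀(N))`, `N ≥ 1`,
with Fourier coefficients `aₙ = cuspCoeff f n` and the tree's un-normalised Petersson norm
`(f, f) = peterssonProduct (Γ₀(N)) 2 f f` (`= ∬_{Γ₀(N)\\ℍ} |f|² dx dy`, `HeckeOperators.lean`):

  `lim_{s → 1⁺} (s − 1) · Σₙ |aₙ|² Γ(s+1) (4πn)^{-(s+1)} = 3 (f, f) / (π [SL₂(ℤ) : Γ₀(N)])`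

(`tendsto_sub_one_mul_tsum_normSq_cuspCoeff`; `[SL₂(ℤ):Γ₀(N)] = gamma0Index N = N∏_{p∣N}(1+1/p)`,
`ModularCurve.lean`), i.e. with `w = s + 1`:
`lim_{w→2⁺} (w − 2) Σ |aₙ|² n^{-w} = 48π (f, f)/[SL₂(ℤ):Γ₀(N)]` — Rankin's theorem (1939) on
`Γ₀(N)`: the Dirichlet series `Σ|aₙ|²n^{-w}` has "residue" proportional to `(f,f)/vol(Γ₀(N)\\ℍ)`
at `w = k = 2` (Iwaniec, *Topics in classical automorphic forms*, Thm. 13.?; Diamond–Shurman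
§5.10; for the use in Murty 1999, §2 and Watkins 2004, §1: `(f,f) ≍ N · L(Sym² E, 1)`).

## Proof (assembling the six previous bricks)

* Step A (`ℝ≥0∞`, exact for every real `s > 1`):
  `∫⁻_F |f|²y² · G_N(τ, s) dμ = 2 Σₙ |aₙ|² Γ(s+1)(4πn)^{-(s+1)}`, `F = ⋃_q g_q⁻¹𝒟ᵒ` the tree's
  fundamental domain of `Γ₀(N)`, `G_N(τ,s) = Σ_{(c,d)=1, N∣c}(y/|cτ+d|²)ˢ` — the unfolding
  (`Gamma0RankinSelbergUnfolding.lintegral_domain_mul_eisenstein_eq`, with the `Γ₀(N)`-invariance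
  of `|f|²y²`, `normSq_mul_im_sq_smul`) and the strip integral
  (`RankinSelbergStripIntegral.lintegral_strip_normSq_mul_rpow` with `a = s + 2`).
* Step B (majorant on `F`, `1 < s ≤ 2`): `(s−1)G_N(τ,s) ≤ (s−1)G₁(g_{q₀}τ, s) ≤ 60(1 + Im(g_{q₀}τ)²)
  ≤ 60 Σ_q (1 + Im(g_qτ)²)` for `τ ∈ g_{q₀}⁻¹𝒟ᵒ` (`Gamma0EisensteinBound`).
* Step C (integrability of `|f|²y² · 60Σ_q(1 + Im(g_qτ)²)` on `F`): `∫_F |f|²y² < ∞` (the tree's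
  Petersson integrability) and `∫_{g_{q₀}⁻¹𝒟ᵒ} |f|²y² Im(g_qτ)² ≤ ∫ |f|²y²(2Im(g_{q₀}τ)² + 8)`
  (`im_smul_le_im_add_two`), while `∫_{g⁻¹𝒟ᵒ}|f|²y²Im(gτ)² = ∫_{𝒟ᵒ}|f∣g⁻¹|²y⁴ < ∞` by the
  exponential decay of the translated cusp form (`exists_norm_le_exp_neg`,
  `exists_normSq_mul_im_pow_four_le`, `lintegral_piece_normSq_mul_im_smul_sq_lt_top`).
* Step D: dominated convergence (`tendsto_integral_filter_of_dominated_convergence` on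
  `volume.restrict F`, filter `𝓝[>] 1`) with the pointwise limit `(s−1)G_N(τ,s) → 6/(π·gamma0Index N)`
  (`Gamma0EisensteinResidue.tendsto_sub_one_mul_tsum_coprime_dvd`).
* Step E: `∫_F |f|²y² = Re (f,f)` (the tree's `peterssonProduct_self_eq_lintegral`,
  `lintegral_fd_sum_eq_lintegral_domain`) and the real form of Step A.

What is NOT here: the relation of the residue with `L(1, Sym² f)` and its local factors, and the
Hoffstein–Lockhart lower bound — see `NewformPeterssonSizeRankinSelbergProofs.lean` for the exact
remaining input.

## References

* R. A. Rankin, *Contributions to the theory of Ramanujan's function τ(n) and similar arithmetical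
  functions II*, Proc. Cambridge Philos. Soc. 35 (1939), 357–372 (the method and the residue).
* [Iwaniec2002] H. Iwaniec, *Spectral Methods of Automorphic Forms*, GSM 53, §3.2, (3.26), (6.33).
* [DiamondShurman2005] F. Diamond, J. Shurman, GTM 228, §5.4, §5.10.
* [Murty1999CongruencePrimes] M. R. Murty, *Bounds for congruence primes* (1999), §2.
* [Watkins2004] M. Watkins, *Explicit lower bounds on the modular degree of an elliptic curve*,
  §1 (`(f,f)` versus `L(Sym² E, 1)`).
-/

noncomputable section

open scoped MatrixGroups ModularForm Modular Real Topology ENNReal NNReal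
open UpperHalfPlane hiding I
open MeasureTheory Set Filter Asymptotics ModularGroup ConjAct Pointwise CongruenceSubgroup
open Literature.NumberTheory.Automorphic

namespace Literature.NumberTheory.EllipticCurves.ModularForms


/-! ### Exponential decay and the weight `|f|²y⁴` -/

section ExpDecay

/-- **Quantitative exponential decay at `i∞`**: a cusp form `f` of arithmetic level satisfies
`‖f(τ)‖ ≤ C e^{-c Im τ}` for `Im τ ≥ A`, some `c > 0`, `C ≥ 0`, `A` (Mathlib
`CuspFormClass.exp_decay_atImInfty'`, made explicit). [folklore] -/
theorem exists_norm_le_exp_neg {Λ : Subgroup (GL (Fin 2) ℝ)} [Λ.IsArithmetic] {k : ℤ}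
    (f : CuspForm Λ k) :
    ∃ C c A : ℝ, 0 < c ∧ 0 ≤ C ∧ ∀ τ : ℍ, A ≤ τ.im → ‖f τ‖ ≤ C * Real.exp (-c * τ.im) := by
  obtain ⟨c, hc, hO⟩ := CuspFormClass.exp_decay_atImInfty' f
  obtain ⟨C, hC⟩ := hO.bound
  obtain ⟨A, hA⟩ := (UpperHalfPlane.atImInfty_mem _).mp hC
  refine ⟨max C 0, c, A, hc, le_max_right _ _, fun τ hτ ↦ ?_⟩
  have h := hA τ hτ
  simp only [mem_setOf_eq, Real.norm_eq_abs, abs_of_pos (Real.exp_pos _)] at h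
  exact h.trans (mul_le_mul_of_nonneg_right (le_max_left _ _) (Real.exp_pos _).le)

/-- For a weight-`2` cusp form `f` of arithmetic level, `‖f(z)‖² (Im z)⁴` is bounded on `ℍ`
(exponential decay for `Im z ≥ A`, with `y⁴e^{-cy} ≤ 24/c⁴`; the Petersson bound
`‖f‖²y² ≤ B` below). [folklore] -/
theorem exists_normSq_mul_im_pow_four_le {Λ : Subgroup (GL (Fin 2) ℝ)} [Λ.IsArithmetic]
    (f : CuspForm Λ 2) : ∃ M : ℝ, ∀ z : ℍ, ‖f z‖ ^ 2 * z.im ^ 4 ≤ M := by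
  obtain ⟨C, c, A, hc, hC, hdec⟩ := exists_norm_le_exp_neg f
  obtain ⟨B, hB⟩ := CuspFormClass.petersson_bounded_left 2 Λ f f
  have hB' : ∀ z : ℍ, ‖f z‖ ^ 2 * z.im ^ 2 ≤ B := fun z ↦ by
    have h := hB z
    rw [petersson_self_eq_ofReal, Complex.norm_real, Real.norm_of_nonneg (by positivity)] at h
    exact_mod_cast h
  have hB0 : 0 ≤ B := le_trans (by positivity) (hB' UpperHalfPlane.I)
  set A' : ℝ := max A 0 with hA'
  refine ⟨C ^ 2 * (24 / c ^ 4) + B * A' ^ 2, fun z ↦ ?_⟩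
  have hy := z.im_pos
  by_cases hz : A' ≤ z.im
  · -- large imaginary part: exponential decay
    have h1 : ‖f z‖ ≤ C * Real.exp (-c * z.im) := hdec z ((le_max_left _ _).trans hz)
    have h2 : ‖f z‖ ^ 2 ≤ C ^ 2 * Real.exp (-c * z.im) ^ 2 := by
      rw [← mul_pow]; exact pow_le_pow_left₀ (norm_nonneg _) h1 2
    have h3 : z.im ^ 4 ≤ 24 / c ^ 4 * Real.exp (c * z.im) := by
      have h := Real.pow_div_factorial_le_exp (c * z.im) (show 0 ≤ c * z.im by positivity) 4
      rw [show (Nat.factorial 4 : ℝ) = 24 by norm_num, mul_pow, div_le_iff₀ (by norm_num)] at h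
      rw [div_mul_eq_mul_div, le_div_iff₀ (by positivity)]
      linarith
    have h4 : Real.exp (-c * z.im) ^ 2 * (24 / c ^ 4 * Real.exp (c * z.im)) ≤ 24 / c ^ 4 := by
      rw [show Real.exp (-c * z.im) ^ 2 * (24 / c ^ 4 * Real.exp (c * z.im)) =
        24 / c ^ 4 * (Real.exp (-c * z.im) * (Real.exp (-c * z.im) * Real.exp (c * z.im))) by ring,
        ← Real.exp_add, show -c * z.im + c * z.im = 0 by ring, Real.exp_zero, mul_one]
      have : Real.exp (-c * z.im) ≤ 1 := Real.exp_le_one_iff.mpr (by nlinarith)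
      have h24 : 0 ≤ 24 / c ^ 4 := by positivity
      nlinarith
    calc ‖f z‖ ^ 2 * z.im ^ 4 ≤ (C ^ 2 * Real.exp (-c * z.im) ^ 2) * (24 / c ^ 4 * Real.exp (c * z.im)) :=
          mul_le_mul h2 h3 (by positivity) (by positivity)
      _ = C ^ 2 * (Real.exp (-c * z.im) ^ 2 * (24 / c ^ 4 * Real.exp (c * z.im))) := by ring
      _ ≤ C ^ 2 * (24 / c ^ 4) := by gcongr
      _ ≤ C ^ 2 * (24 / c ^ 4) + B * A' ^ 2 := by nlinarith [sq_nonneg A']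
  · -- small imaginary part: the Petersson bound
    push Not at hz
    have hA0 : 0 ≤ A' := le_max_right _ _
    calc ‖f z‖ ^ 2 * z.im ^ 4 = (‖f z‖ ^ 2 * z.im ^ 2) * z.im ^ 2 := by ring
      _ ≤ B * A' ^ 2 := mul_le_mul (hB' z) (pow_le_pow_left₀ hy.le hz.le 2) (by positivity) hB0
      _ ≤ C ^ 2 * (24 / c ^ 4) + B * A' ^ 2 := by
          have : 0 ≤ C ^ 2 * (24 / c ^ 4) := by positivity
          linarith

end ExpDecay

/-! ### Finiteness on the translates of `𝒟ᵒ` -/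

section PieceIntegral

variable {Γ : Subgroup (GL (Fin 2) ℝ)} [Γ.IsArithmetic]

/-- On a translate `s⁻¹𝒟ᵒ` of the open fundamental domain (`s ∈ SL(2, ℤ)`), the weight
`|f(τ)|² (Im τ)² · Im(sτ)²` of a weight-`2` cusp form of arithmetic level has finite hyperbolic
integral: substituting `z = sτ` it is `∫_{𝒟} |f∣s⁻¹|²(z) (Im z)⁴ dμ`, and `|f∣s⁻¹|² y⁴` is bounded
(`exists_normSq_mul_im_pow_four_le` for the translated cusp form `CuspForm.translate f s⁻¹`)
while `vol(𝒟) < ∞`. [folklore] -/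
theorem lintegral_piece_normSq_mul_im_smul_sq_lt_top (f : CuspForm Γ 2) (s : SL(2, ℤ)) :
    ∫⁻ τ in {τ : ℍ | s • τ ∈ 𝒟ᵒ}, ENNReal.ofReal (‖f τ‖ ^ 2 * τ.im ^ 2 * (s • τ).im ^ 2) < ∞ := by
  set G : ℍ → ℝ≥0∞ := fun τ ↦ ENNReal.ofReal (‖f τ‖ ^ 2 * τ.im ^ 2 * (s • τ).im ^ 2) with hG
  have h1 : ∫⁻ τ in {τ : ℍ | s • τ ∈ 𝒟ᵒ}, G τ = ∫⁻ σ in 𝒟, G (s⁻¹ • σ) := by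
    rw [← setLIntegral_setOf_smul_mem_fd_eq s G, ← setLIntegral_fd_comp_inv_smul s G]
  rw [h1]
  -- the translated cusp form
  set b : GL (Fin 2) ℝ := Matrix.SpecialLinearGroup.mapGL ℝ s with hb
  have hbmem : b ∈ 𝒮ℒ := ⟨s, rfl⟩
  haveI := isArithmetic_conj_of_mem_SL Γ (inv_mem hbmem)
  set f' := CuspForm.translate f b⁻¹ with hf'
  have hpt : ∀ σ : ℍ, G (s⁻¹ • σ) = ENNReal.ofReal (‖f' σ‖ ^ 2 * σ.im ^ 4) := by
    intro σ
    rw [hG]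
    dsimp only
    rw [smul_inv_smul]
    congr 1
    have hp : ‖f (s⁻¹ • σ)‖ ^ 2 * (s⁻¹ • σ).im ^ 2 = ‖f' σ‖ ^ 2 * σ.im ^ 2 := by
      have h := UpperHalfPlane.petersson_slash_SL 2 ⇑f ⇑f s⁻¹ σ
      have hcoe : (⇑f' : ℍ → ℂ) = ⇑f ∣[(2 : ℤ)] s⁻¹ := by
        rw [hf', coe_cuspForm_translate, hb, ← map_inv, ModularForm.SL_slash]
        rfl
      have h2 := congrArg (fun x : ℂ ↦ ‖x‖) h
      rw [← hcoe, petersson_self_eq_ofReal, petersson_self_eq_ofReal, Complex.norm_real, Complex.norm_real,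
        Real.norm_of_nonneg (by positivity), Real.norm_of_nonneg (by positivity)] at h2
      exact_mod_cast h2.symm
    calc ‖f (s⁻¹ • σ)‖ ^ 2 * (s⁻¹ • σ).im ^ 2 * σ.im ^ 2 = (‖f' σ‖ ^ 2 * σ.im ^ 2) * σ.im ^ 2 := by rw [hp]
      _ = ‖f' σ‖ ^ 2 * σ.im ^ 4 := by ring
  simp_rw [hpt]
  obtain ⟨M, hM⟩ := exists_normSq_mul_im_pow_four_le f'
  calc ∫⁻ σ in 𝒟, ENNReal.ofReal (‖f' σ‖ ^ 2 * σ.im ^ 4)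
      ≤ ∫⁻ σ in 𝒟, ENNReal.ofReal M := lintegral_mono fun σ ↦ ENNReal.ofReal_le_ofReal (hM σ)
    _ = ENNReal.ofReal M * volume 𝒟 := by rw [lintegral_const, Measure.restrict_apply_univ]
    _ < ∞ := ENNReal.mul_lt_top ENNReal.ofReal_lt_top volume_fd_lt_top

end PieceIntegral

/-! ### Heights -/

section Heights

/-- Points of `𝒟ᵒ` have imaginary part `> 1/2` (indeed `> √3/2`). [folklore] -/
theorem half_lt_im_of_mem_fdo {z : ℍ} (hz : z ∈ 𝒟ᵒ) : 1 / 2 < z.im := by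
  have h := ModularGroup.three_lt_four_mul_im_sq_of_mem_fdo hz
  have hy := z.im_pos
  nlinarith

/-- `Im(hz) ≤ Im z + 2` for `h ∈ SL(2, ℤ)` and `Im z ≥ 1/2`: `Im(hz) = y/|cz+d|²` is `y` if `c = 0`
and at most `1/y ≤ 2` otherwise. [folklore] -/
theorem im_smul_le_im_add_two (h : SL(2, ℤ)) {z : ℍ} (hz : 1 / 2 ≤ z.im) : (h • z).im ≤ z.im + 2 := by
  have hy := z.im_pos
  rw [ModularGroup.im_smul_eq_div_normSq, ModularGroup.denom_apply]
  have hns : Complex.normSq ((h 1 0 : ℂ) * z + h 1 1) =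
      ((h 1 0 : ℝ) * z.re + h 1 1) ^ 2 + ((h 1 0 : ℝ) * z.im) ^ 2 := by
    rw [Complex.normSq_apply]
    simp [sq]
  rw [hns]
  by_cases hc : h 1 0 = 0
  · -- then `d = ±1`
    have hdet := h.det_coe
    rw [Matrix.det_fin_two, hc, mul_zero, sub_zero] at hdet
    have hd : h 1 1 = 1 ∨ h 1 1 = -1 := Int.eq_one_or_neg_one_of_mul_eq_one' hdet |>.elim
      (fun h1 ↦ Or.inl h1.2) (fun h1 ↦ Or.inr h1.2)
    have hd2 : ((h 1 1 : ℤ) : ℝ) ^ 2 = 1 := by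
      rcases hd with hd | hd <;> simp [hd]
    simp only [hc, Int.cast_zero, zero_mul, zero_add, zero_pow, ne_eq, OfNat.ofNat_ne_zero,
      not_false_eq_true, add_zero, hd2, div_one]
    linarith
  · have hc1 : (1 : ℝ) ≤ ((h 1 0 : ℤ) : ℝ) ^ 2 := by
      have : 1 ≤ (h 1 0) ^ 2 := by
        have h0 : h 1 0 ≠ 0 := hc
        nlinarith [sq_nonneg (h 1 0), Int.one_le_abs h0, sq_abs (h 1 0)]
      exact_mod_cast this
    have hden : z.im ^ 2 ≤ ((h 1 0 : ℝ) * z.re + h 1 1) ^ 2 + ((h 1 0 : ℝ) * z.im) ^ 2 := by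
      nlinarith [sq_nonneg ((h 1 0 : ℝ) * z.re + h 1 1), sq_nonneg z.im]
    have hpos : 0 < ((h 1 0 : ℝ) * z.re + h 1 1) ^ 2 + ((h 1 0 : ℝ) * z.im) ^ 2 :=
      lt_of_lt_of_le (by positivity) hden
    calc z.im / (((h 1 0 : ℝ) * z.re + h 1 1) ^ 2 + ((h 1 0 : ℝ) * z.im) ^ 2)
        ≤ z.im / z.im ^ 2 := div_le_div_of_nonneg_left hy.le (by positivity) hden
      _ = 1 / z.im := by field_simp
      _ ≤ 2 := by rw [div_le_iff₀ hy]; linarith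
      _ ≤ z.im + 2 := by linarith

end Heights


/-! ### The residue identity -/

section Residue

variable {N : ℕ} [NeZero N]

omit [NeZero N] in
/-- The Petersson weight `|f(τ)|² (Im τ)²` of `f ∈ S₂(Γ₀(N))` is `Γ₀(N)`-invariant (Mathlib
`SlashInvariantFormClass.petersson_smul`). [folklore] -/
theorem normSq_mul_im_sq_smul (f : CuspForm (Gamma0 N) 2) {δ : SL(2, ℤ)} (hδ : δ ∈ Gamma0 N) (τ : ℍ) :
    ‖f (δ • τ)‖ ^ 2 * (δ • τ).im ^ 2 = ‖f τ‖ ^ 2 * τ.im ^ 2 := by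
  have hmem : (Matrix.SpecialLinearGroup.mapGL ℝ δ : GL (Fin 2) ℝ) ∈
      (Gamma0 N : Subgroup (GL (Fin 2) ℝ)) := Subgroup.mem_map_of_mem _ hδ
  have h := SlashInvariantFormClass.petersson_smul (f := f) (f' := f) (k := 2) hmem (τ := τ)
  change petersson 2 ⇑f ⇑f (δ • τ) = petersson 2 ⇑f ⇑f τ at h
  have h2 := congrArg (fun x : ℂ ↦ ‖x‖) h
  rw [petersson_self_eq_ofReal, petersson_self_eq_ofReal, Complex.norm_real, Complex.norm_real,
    Real.norm_of_nonneg (by positivity), Real.norm_of_nonneg (by positivity)] at h2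
  exact_mod_cast h2

/-- `τ ↦ G_M(τ, s) = Σ_{(c,d)=1, M∣c}(Im τ/|cτ+d|²)ˢ` is measurable (`s > 1`; it is the real part
of a countable sum of continuous nonnegative functions). [folklore] -/
theorem measurable_tsum_coprime_dvd {s : ℝ} (hs : 1 < s) (M : ℕ) :
    Measurable fun τ : ℍ ↦ ∑' v : {v : Fin 2 → ℤ // IsCoprime (v 0) (v 1) ∧ (M : ℤ) ∣ v 0},
      (τ.im / Complex.normSq ((v.1 0 : ℂ) * τ + v.1 1)) ^ s := by
  have hq : ∀ (τ : ℍ) (p : Fin 2 → ℤ), 0 ≤ τ.im / Complex.normSq ((p 0 : ℂ) * τ + p 1) := fun τ p ↦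
    div_nonneg τ.im_pos.le (Complex.normSq_nonneg _)
  have heq : (fun τ : ℍ ↦ ∑' v : {v : Fin 2 → ℤ // IsCoprime (v 0) (v 1) ∧ (M : ℤ) ∣ v 0},
      (τ.im / Complex.normSq ((v.1 0 : ℂ) * τ + v.1 1)) ^ s) = fun τ : ℍ ↦
      (∑' v : {v : Fin 2 → ℤ // IsCoprime (v 0) (v 1) ∧ (M : ℤ) ∣ v 0},
        ENNReal.ofReal ((τ.im / Complex.normSq ((v.1 0 : ℂ) * (τ : ℂ) + v.1 1)) ^ s)).toReal := by
    funext τ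
    rw [← ENNReal.ofReal_tsum_of_nonneg (fun v ↦ Real.rpow_nonneg (hq τ _) _)
      ((summable_rpow_im_div_normSq τ hs).comp_injective Subtype.val_injective),
      ENNReal.toReal_ofReal (tsum_nonneg fun v ↦ Real.rpow_nonneg (hq τ _) _)]
  rw [heq]
  refine Measurable.ennreal_toReal (Measurable.tsum fun v ↦ Measurable.ennreal_ofReal ?_)
  refine Measurable.pow_const (Measurable.div continuous_im.measurable ?_) _
  exact (Complex.continuous_normSq.comp ((continuous_const.mul continuous_coe).add continuous_const)).measurable

/-- **The Rankin–Selberg residue identity for the Petersson norm on `Γ₀(N)`.** For every cusp form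
`f ∈ S₂(Γ₀(N))`, `N ≥ 1`, with `aₙ = cuspCoeff f n` and the tree's un-normalised Petersson norm
`(f, f) = peterssonProduct (Γ₀(N)) 2 f f` (`= ∬_{Γ₀(N)\\ℍ}|f|² dx dy`):
`(s − 1) · Σₙ |aₙ|² Γ(s+1) (4πn)^{-(s+1)} → 3 Re(f, f) / (π · gamma0Index N)` as `s → 1⁺`
(`gamma0Index N = [SL₂(ℤ):Γ₀(N)]`), i.e. `lim_{w→2⁺}(w−2)Σ|aₙ|²n^{-w} = 48π(f,f)/[SL₂(ℤ):Γ₀(N)]`: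
Rankin–Selberg unfolding against the Eisenstein series of the cusp `∞` of `Γ₀(N)`, the strip
integral, the residue `3/(π[SL₂(ℤ):Γ₀(N)])` of that Eisenstein series and dominated convergence
(Steps A–E of the module docstring). (Rankin 1939; Murty 1999, §2; Iwaniec (3.26)/(6.33).)
[cite: Murty1999CongruencePrimes, §2 (proof of Thm. 1: (f,f) via the residue of the Rankin–Selberg convolution)] -/
theorem tendsto_sub_one_mul_tsum_normSq_cuspCoeff (f : CuspForm (Gamma0 N) 2) :
    Tendsto (fun s : ℝ ↦ (s - 1) * ∑' n : ℕ, ‖cuspCoeff f n‖ ^ 2 *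
        ((1 / (4 * π * n)) ^ (s + 1) * Real.Gamma (s + 1)))
      (𝓝[>] 1) (𝓝 (3 * (peterssonProduct (Gamma0 N) 2 f f).re / (π * gamma0Index N))) := by
  classical
  obtain ⟨g, hg⟩ := exists_mapGL_eq_out (N := N)
  letI : Fintype (↥𝒮ℒ ⧸ (Gamma0 N : Subgroup (GL (Fin 2) ℝ)).subgroupOf 𝒮ℒ) := Fintype.ofFinite _
  have hN : 0 < N := NeZero.pos N
  have hΓ : (1 : ℝ) ∈ (Gamma0 N : Subgroup (GL (Fin 2) ℝ)).strictPeriods :=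
    strictWidthInfty_Gamma0 N ▸ Subgroup.strictWidthInfty_mem_strictPeriods _
  -- notation (`F` kept opaque, with its defining equation `hFdef`)
  obtain ⟨F, hFdef⟩ : ∃ F : Set ℍ, F = ⋃ q, {τ : ℍ | g q • τ ∈ 𝒟ᵒ} := ⟨_, rfl⟩
  have hF : MeasurableSet F := by rw [hFdef]; exact measurableSet_domain g
  set Φr : ℍ → ℝ := fun τ ↦ ‖f τ‖ ^ 2 * τ.im ^ 2 with hΦr
  have hΦr_nonneg : ∀ τ, 0 ≤ Φr τ := fun τ ↦ by rw [hΦr]; positivity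
  have hΦr_cont : Continuous Φr :=
    ((ModularFormClass.continuous f).norm.pow 2).mul (continuous_im.pow 2)
  set GN : ℍ → ℝ → ℝ := fun τ s ↦ ∑' v : {v : Fin 2 → ℤ // IsCoprime (v 0) (v 1) ∧ (N : ℤ) ∣ v 0},
    (τ.im / Complex.normSq ((v.1 0 : ℂ) * τ + v.1 1)) ^ s with hGN
  set G1 : ℍ → ℝ → ℝ := fun τ s ↦ ∑' v : {v : Fin 2 → ℤ // IsCoprime (v 0) (v 1) ∧ ((1 : ℕ) : ℤ) ∣ v 0},
    (τ.im / Complex.normSq ((v.1 0 : ℂ) * τ + v.1 1)) ^ s with hG1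
  have hq : ∀ (τ : ℍ) (p : Fin 2 → ℤ), 0 ≤ τ.im / Complex.normSq ((p 0 : ℂ) * τ + p 1) := fun τ p ↦
    div_nonneg τ.im_pos.le (Complex.normSq_nonneg _)
  have hGN_nonneg : ∀ τ s, 0 ≤ GN τ s := fun τ s ↦ tsum_nonneg fun v ↦ Real.rpow_nonneg (hq τ _) _
  set c : ℕ → ℝ → ℝ := fun n s ↦ ‖cuspCoeff f n‖ ^ 2 * ((1 / (4 * π * n)) ^ (s + 1) * Real.Gamma (s + 1))
    with hc
  have hc_nonneg : ∀ n : ℕ, ∀ s : ℝ, 1 < s → 0 ≤ c n s := fun n s hs ↦ by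
    rw [hc]
    dsimp only
    have : 0 < Real.Gamma (s + 1) := Real.Gamma_pos_of_pos (by linarith)
    positivity
  -- ### Step A: the unfolded identity in `ℝ≥0∞`
  have hΦinv : ∀ δ ∈ Gamma0 N, ∀ τ : ℍ, ENNReal.ofReal (Φr (δ • τ)) = ENNReal.ofReal (Φr τ) := by
    intro δ hδ τ
    rw [hΦr]
    dsimp only
    rw [normSq_mul_im_sq_smul f hδ τ]
  have hΦm : Measurable fun τ ↦ ENNReal.ofReal (Φr τ) := hΦr_cont.measurable.ennreal_ofReal
  have stepA : ∀ s : ℝ, 1 < s →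
      ∫⁻ τ in F, ENNReal.ofReal (Φr τ) * ENNReal.ofReal (GN τ s) =
        2 * ∑' n : ℕ, ENNReal.ofReal (c n s) := by
    intro s hs
    have hU := lintegral_domain_mul_eisenstein_eq g hg (fun τ ↦ ENNReal.ofReal (Φr τ)) hΦm hΦinv
      (fun y ↦ ENNReal.ofReal (y ^ s)) ((measurable_id.pow_const s).ennreal_ofReal)
    -- the inner sum is `ofReal (GN τ s)`
    have hinner : ∀ τ : ℍ, ∑' v : {v : Fin 2 → ℤ // IsCoprime (v 0) (v 1) ∧ (N : ℤ) ∣ v 0},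
        ENNReal.ofReal ((τ.im / Complex.normSq ((v.1 0 : ℂ) * τ + v.1 1)) ^ s) = ENNReal.ofReal (GN τ s) := by
      intro τ
      rw [hGN]
      exact (ENNReal.ofReal_tsum_of_nonneg (fun v ↦ Real.rpow_nonneg (hq τ _) _)
        ((summable_rpow_im_div_normSq τ hs).comp_injective Subtype.val_injective)).symm
    simp_rw [hinner] at hU
    rw [← hFdef] at hU
    rw [hU]
    -- the strip integral
    have hstrip : ∫⁻ ρ in {ρ : ℍ | 0 ≤ ρ.re ∧ ρ.re < 1}, ENNReal.ofReal (Φr ρ) * ENNReal.ofReal (ρ.im ^ s) =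
        ∫⁻ ρ in {ρ : ℍ | 0 ≤ ρ.re ∧ ρ.re < 1}, ENNReal.ofReal (‖f ρ‖ ^ 2 * ρ.im ^ (s + 2)) := by
      refine lintegral_congr fun ρ ↦ ?_
      rw [hΦr]
      dsimp only
      rw [← ENNReal.ofReal_mul (by positivity)]
      congr 1
      rw [Real.rpow_add ρ.im_pos s 2, Real.rpow_two]
      ring
    rw [hstrip, lintegral_strip_normSq_mul_rpow hΓ f (a := s + 2) (by linarith)]
    congr 1
    refine tsum_congr fun n ↦ ?_
    rw [hc]
    dsimp only
    rw [show s + 2 - 1 = s + 1 by ring]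
  -- ### Step B: the majorant `(s − 1) G_N(τ, s) ≤ B τ` on `F` for `1 < s ≤ 2`
  set B : ℍ → ℝ := fun τ ↦ 60 * ∑ q, (1 + (g q • τ).im ^ 2) with hB
  have hB_nonneg : ∀ τ, 0 ≤ B τ := fun τ ↦ by rw [hB]; positivity
  have hB_cont : Continuous B := by
    rw [hB]
    refine continuous_const.mul (continuous_finsetSum _ fun q _ ↦ ?_)
    exact continuous_const.add ((continuous_im.comp (continuous_sl2z_smul _)).pow 2)
  have hmaj : ∀ s : ℝ, 1 < s → s ≤ 2 → ∀ τ ∈ F, (s - 1) * GN τ s ≤ B τ := by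
    intro s hs1 hs2 τ hτ
    rw [hFdef, mem_iUnion] at hτ
    obtain ⟨q₀, hq₀⟩ := hτ
    have hhalf : 1 / 2 ≤ (g q₀ • τ).im := (half_lt_im_of_mem_fdo hq₀).le
    have h1 : GN τ s ≤ G1 τ s := tsum_coprime_dvd_le_tsum_coprime τ hs1 N
    have h2 : G1 τ s = G1 (g q₀ • τ) s := (tsum_coprime_smul (g q₀) τ s).symm
    have h3 : (s - 1) * G1 (g q₀ • τ) s ≤ 60 * (1 + (g q₀ • τ).im ^ 2) :=
      sub_one_mul_tsum_coprime_le _ hhalf hs1 hs2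
    have h4 : 60 * (1 + (g q₀ • τ).im ^ 2) ≤ B τ := by
      rw [hB]
      dsimp only
      refine mul_le_mul_of_nonneg_left ?_ (by norm_num)
      exact Finset.single_le_sum (f := fun q ↦ 1 + (g q • τ).im ^ 2) (fun q _ ↦ by positivity)
        (Finset.mem_univ q₀)
    have hs0 : 0 ≤ s - 1 := by linarith
    calc (s - 1) * GN τ s ≤ (s - 1) * G1 τ s := mul_le_mul_of_nonneg_left h1 hs0
      _ = (s - 1) * G1 (g q₀ • τ) s := by rw [h2]
      _ ≤ 60 * (1 + (g q₀ • τ).im ^ 2) := h3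
      _ ≤ B τ := h4
  -- ### Step C: integrability of the majorant `Φr · B` on `F`
  have hpiece_sub : ∀ q, {τ : ℍ | g q • τ ∈ 𝒟ᵒ} ⊆ F := fun q ↦ by
    rw [hFdef]; exact subset_iUnion (fun q ↦ {τ : ℍ | g q • τ ∈ 𝒟ᵒ}) q
  have hΦ_lt_top : ∫⁻ τ in F, ENNReal.ofReal (Φr τ) < ∞ := by
    -- `∫⁻_F |f|² y² = ∫⁻_𝒟 Σ_q |f|²y²(g_q⁻¹ ·)`, each summand integrable
    have h := lintegral_fd_sum_eq_lintegral_domain g hg f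
    rw [hΦr]
    change ∫⁻ τ in F, ENNReal.ofReal (‖f τ‖ ^ 2 * τ.im ^ 2) < ∞
    rw [hFdef, ← h]
    have hterm : ∀ q, ∫⁻ τ in 𝒟, ENNReal.ofReal (‖f ((g q)⁻¹ • τ)‖ ^ 2 * ((g q)⁻¹ • τ).im ^ 2) < ∞ := by
      intro q
      have hint := integrableOn_petersson_comp_smul_fd 2 f f
        (b := (Matrix.SpecialLinearGroup.mapGL ℝ (g q) : GL (Fin 2) ℝ)) ⟨g q, rfl⟩
      have hint' : IntegrableOn (fun τ : ℍ ↦ ‖f ((g q)⁻¹ • τ)‖ ^ 2 * ((g q)⁻¹ • τ).im ^ 2) 𝒟 := by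
        refine IntegrableOn.congr_fun hint.norm (fun τ _ ↦ ?_) isClosed_fd.measurableSet
        change ‖petersson 2 ⇑f ⇑f ((Matrix.SpecialLinearGroup.mapGL ℝ (g q) : GL (Fin 2) ℝ)⁻¹ • τ)‖ = _
        rw [← map_inv]
        change ‖petersson 2 ⇑f ⇑f ((g q)⁻¹ • τ)‖ = _
        rw [petersson_self_eq_ofReal, Complex.norm_real, Real.norm_of_nonneg (by positivity)]
        norm_cast
      exact hint'.setLIntegral_lt_top
    rw [lintegral_finsetSum' _ fun q _ ↦ ?_]
    · exact ENNReal.sum_lt_top.mpr fun q _ ↦ hterm q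
    · exact ((((ModularFormClass.continuous f).comp (continuous_sl2z_smul _)).norm.pow 2).mul
        ((continuous_im.comp (continuous_sl2z_smul _)).pow 2)).measurable.ennreal_ofReal.aemeasurable
  have hbound_lt_top : ∫⁻ τ in F, ENNReal.ofReal (Φr τ * B τ) < ∞ := by
    -- `Φr · B = 60 Σ_q (Φr + Φr · Im(g_q τ)²)`
    have hsplit : ∀ τ, ENNReal.ofReal (Φr τ * B τ) =
        60 * ∑ q, (ENNReal.ofReal (Φr τ) + ENNReal.ofReal (Φr τ * (g q • τ).im ^ 2)) := by
      intro τ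
      have e1 : Φr τ * B τ = 60 * ∑ q, (Φr τ + Φr τ * (g q • τ).im ^ 2) := by
        rw [hB]
        dsimp only
        rw [Finset.mul_sum, Finset.mul_sum, Finset.mul_sum]
        refine Finset.sum_congr rfl fun q _ ↦ ?_
        ring
      rw [e1, ENNReal.ofReal_mul (by norm_num), ENNReal.ofReal_sum_of_nonneg (fun q _ ↦ by positivity)]
      have e60 : ENNReal.ofReal 60 = 60 := by norm_num
      rw [e60]
      congr 1
      refine Finset.sum_congr rfl fun q _ ↦ ?_
      rw [ENNReal.ofReal_add (hΦr_nonneg τ) (by positivity)]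
    simp_rw [hsplit]
    have hmeas_q : ∀ q, Measurable fun τ ↦ ENNReal.ofReal (Φr τ) + ENNReal.ofReal (Φr τ * (g q • τ).im ^ 2) :=
      fun q ↦ hΦm.add (hΦr_cont.mul ((continuous_im.comp (continuous_sl2z_smul _)).pow 2)).measurable.ennreal_ofReal
    rw [lintegral_const_mul _ (Finset.measurable_sum _ fun q _ ↦ hmeas_q q),
      lintegral_finsetSum' _ fun q _ ↦ (hmeas_q q).aemeasurable]
    refine ENNReal.mul_lt_top (by norm_num) (ENNReal.sum_lt_top.mpr fun q _ ↦ ?_)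
    rw [lintegral_add_left hΦm]
    refine ENNReal.add_lt_top.mpr ⟨hΦ_lt_top, ?_⟩
    -- `∫⁻_F Φr · Im(g_q τ)² ≤ Σ_{q₀} ∫⁻_{piece q₀} ...`
    rw [hFdef]
    refine lt_of_le_of_lt (lintegral_iUnion_le _ _) ?_
    rw [tsum_fintype]
    refine ENNReal.sum_lt_top.mpr fun q₀ _ ↦ ?_
    -- on the piece `q₀`: `Im(g_q τ)² ≤ 2 Im(g_{q₀} τ)² + 8`
    have hmeasP : Measurable fun τ : ℍ ↦ ENNReal.ofReal (‖f τ‖ ^ 2 * τ.im ^ 2 * (g q₀ • τ).im ^ 2) :=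
      ((((ModularFormClass.continuous f).norm.pow 2).mul (continuous_im.pow 2)).mul
        ((continuous_im.comp (continuous_sl2z_smul _)).pow 2)).measurable.ennreal_ofReal
    have hle : ∫⁻ τ in {τ : ℍ | g q₀ • τ ∈ 𝒟ᵒ}, ENNReal.ofReal (Φr τ * (g q • τ).im ^ 2) ≤
        ∫⁻ τ in {τ : ℍ | g q₀ • τ ∈ 𝒟ᵒ}, (2 * ENNReal.ofReal (‖f τ‖ ^ 2 * τ.im ^ 2 * (g q₀ • τ).im ^ 2) +
          8 * ENNReal.ofReal (Φr τ)) := by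
      refine setLIntegral_mono' (isOpen_setOf_smul_mem_fdo (g q₀)).measurableSet fun τ hτ ↦ ?_
      have hhalf : 1 / 2 ≤ (g q₀ • τ).im := (half_lt_im_of_mem_fdo hτ).le
      have him : (g q • τ).im ≤ (g q₀ • τ).im + 2 := by
        have := im_smul_le_im_add_two (g q * (g q₀)⁻¹) hhalf
        rwa [mul_smul, inv_smul_smul] at this
      have him0 : 0 ≤ (g q • τ).im := ((g q • τ).im_pos).le
      have hsq : (g q • τ).im ^ 2 ≤ 2 * (g q₀ • τ).im ^ 2 + 8 := by
        have h1 : (g q • τ).im ^ 2 ≤ ((g q₀ • τ).im + 2) ^ 2 := pow_le_pow_left₀ him0 him 2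
        nlinarith [h1, sq_nonneg ((g q₀ • τ).im - 2)]
      rw [hΦr]
      dsimp only
      have e2 : (2 : ℝ≥0∞) = ENNReal.ofReal 2 := by norm_num
      have e8 : (8 : ℝ≥0∞) = ENNReal.ofReal 8 := by norm_num
      rw [e2, e8, ← ENNReal.ofReal_mul (by norm_num), ← ENNReal.ofReal_mul (by norm_num),
        ← ENNReal.ofReal_add (by positivity) (by positivity)]
      refine ENNReal.ofReal_le_ofReal ?_
      have hP : 0 ≤ ‖f τ‖ ^ 2 * τ.im ^ 2 := by positivity
      nlinarith
    refine lt_of_le_of_lt hle ?_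
    rw [lintegral_add_left (hmeasP.const_mul 2), lintegral_const_mul _ hmeasP, lintegral_const_mul _ hΦm]
    refine ENNReal.add_lt_top.mpr ⟨ENNReal.mul_lt_top (by norm_num)
      (lintegral_piece_normSq_mul_im_smul_sq_lt_top f (g q₀)), ENNReal.mul_lt_top (by norm_num) ?_⟩
    exact lt_of_le_of_lt (lintegral_mono_set (hpiece_sub q₀)) hΦ_lt_top
  -- ### Step D: dominated convergence on `F`
  set h : ℝ → ℍ → ℝ := fun s τ ↦ Φr τ * ((s - 1) * GN τ s) with hh
  have hGN_meas : ∀ s : ℝ, 1 < s → Measurable fun τ ↦ GN τ s := fun s hs ↦ by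
    rw [hGN]; exact measurable_tsum_coprime_dvd hs N
  have hh_meas : ∀ s : ℝ, 1 < s → AEStronglyMeasurable (h s) (volume.restrict F) := fun s hs ↦
    (hΦr_cont.measurable.mul ((hGN_meas s hs).const_mul _)).aestronglyMeasurable
  have hD1 : ∀ᶠ s in 𝓝[>] (1 : ℝ), AEStronglyMeasurable (h s) (volume.restrict F) := by
    filter_upwards [self_mem_nhdsWithin] with s hs using hh_meas s hs
  have hD2 : ∀ᶠ s in 𝓝[>] (1 : ℝ), ∀ᵐ τ ∂(volume.restrict F), ‖h s τ‖ ≤ Φr τ * B τ := by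
    filter_upwards [Ioc_mem_nhdsGT (show (1 : ℝ) < 2 by norm_num)] with s hs
    filter_upwards [ae_restrict_mem hF] with τ hτ
    rw [hh]
    dsimp only
    rw [Real.norm_eq_abs, abs_of_nonneg (mul_nonneg (hΦr_nonneg τ) (mul_nonneg (by linarith [hs.1]) (hGN_nonneg τ s)))]
    exact mul_le_mul_of_nonneg_left (hmaj s hs.1 hs.2 τ hτ) (hΦr_nonneg τ)
  have hD3 : Integrable (fun τ ↦ Φr τ * B τ) (volume.restrict F) := by
    refine ⟨(hΦr_cont.mul hB_cont).aestronglyMeasurable, ?_⟩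
    rw [hasFiniteIntegral_iff_ofReal (ae_of_all _ fun τ ↦ mul_nonneg (hΦr_nonneg τ) (hB_nonneg τ))]
    exact hbound_lt_top
  have hD4 : ∀ᵐ τ ∂(volume.restrict F), Tendsto (fun s ↦ h s τ) (𝓝[>] 1) (𝓝 (Φr τ * (6 / (π * gamma0Index N)))) :=
    ae_of_all _ fun τ ↦ ((tendsto_sub_one_mul_tsum_coprime_dvd τ hN).const_mul (Φr τ))
  have hDCT := tendsto_integral_filter_of_dominated_convergence (fun τ ↦ Φr τ * B τ) hD1 hD2 hD3 hD4
  -- ### Step E: identify both sides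
  have hPet : (peterssonProduct (Gamma0 N) 2 f f).re = (∫⁻ τ in F, ENNReal.ofReal (Φr τ)).toReal := by
    rw [peterssonProduct_self_eq_lintegral g hg f, Complex.ofReal_re, lintegral_fd_sum_eq_lintegral_domain g hg f,
      hFdef]
  have hlimval : ∫ τ in F, Φr τ * (6 / (π * gamma0Index N)) =
      (6 / (π * gamma0Index N)) * (peterssonProduct (Gamma0 N) 2 f f).re := by
    rw [integral_mul_const, mul_comm (∫ τ in F, Φr τ), hPet,
      integral_eq_lintegral_of_nonneg_ae (ae_of_all _ hΦr_nonneg) hΦr_cont.aestronglyMeasurable]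
  have hval : ∀ s : ℝ, 1 < s → s ≤ 2 → ∫ τ in F, h s τ = (s - 1) * (2 * ∑' n : ℕ, c n s) := by
    intro s hs1 hs2
    rw [hh]
    dsimp only
    have e1 : ∫ τ in F, Φr τ * ((s - 1) * GN τ s) = (s - 1) * ∫ τ in F, Φr τ * GN τ s := by
      rw [← integral_const_mul]
      congr 1
      funext τ
      ring
    rw [e1]
    congr 1
    rw [integral_eq_lintegral_of_nonneg_ae (ae_of_all _ fun τ ↦ mul_nonneg (hΦr_nonneg τ) (hGN_nonneg τ s))
      (hΦr_cont.measurable.mul (hGN_meas s hs1)).aestronglyMeasurable]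
    have e2 : ∫⁻ τ in F, ENNReal.ofReal (Φr τ * GN τ s) = 2 * ∑' n : ℕ, ENNReal.ofReal (c n s) := by
      rw [← stepA s hs1]
      refine lintegral_congr fun τ ↦ ?_
      rw [ENNReal.ofReal_mul (hΦr_nonneg τ)]
    rw [e2, ENNReal.toReal_mul, ENNReal.tsum_toReal_eq fun n ↦ ENNReal.ofReal_ne_top]
    have e3 : ∑' n : ℕ, (ENNReal.ofReal (c n s)).toReal = ∑' n : ℕ, c n s :=
      tsum_congr fun n ↦ ENNReal.toReal_ofReal (hc_nonneg n s hs1)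
    rw [e3, ENNReal.toReal_ofNat]
  -- conclude
  have hlim2 : Tendsto (fun s : ℝ ↦ (s - 1) * (2 * ∑' n : ℕ, c n s)) (𝓝[>] 1)
      (𝓝 ((6 / (π * gamma0Index N)) * (peterssonProduct (Gamma0 N) 2 f f).re)) := by
    rw [← hlimval]
    refine hDCT.congr' ?_
    filter_upwards [Ioc_mem_nhdsGT (show (1 : ℝ) < 2 by norm_num)] with s hs
    exact hval s hs.1 hs.2
  have hlim3 := hlim2.mul_const (1 / 2)
  have hval2 : 6 / (π * ↑(gamma0Index N)) * (peterssonProduct (Gamma0 N) 2 f f).re * (1 / 2) =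
      3 * (peterssonProduct (Gamma0 N) 2 f f).re / (π * gamma0Index N) := by ring
  rw [hval2] at hlim3
  refine hlim3.congr fun s ↦ ?_
  rw [hc]
  beta_reduce
  ring

end Residue

end Literature.NumberTheory.EllipticCurves.ModularForms

end
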